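import Summits.CriticalPhenomena.PercolationContinuityZ3.Theorems.PercNearOneGluingNoHeavyConstsTwoSourceBHKCore
import HarnessLib

/-!
# Two-source van den Berg–Häggström–Kahn for DECREASING functionals (sum form and measure form)
# (PAPER-2 track (ii); seat `prim-consts-2`, gen 15)

builds on p205010 (kernel theorem, internal audit signed; external expert review pending).  Support file
(`--supports stmt-CriticalPhenomena-4575`); memo `run/shared/lean/prim/consts/FROM-prim-consts-2-g15-TWO-SOURCE.md` §0(1).
Theorems only (the bookkeeping defs `rCS`, `rDS`, `blockES` are those of `…ConstsTwoSourceBHKCore.lean`); no sorries; standard axioms.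

Companion of `Consts.TwoSource.core₂` / `Consts.twoSource_twoSet` (increasing `F, G`: the sources enter with union where the repelled
sets enter with intersection).  For DECREASING functionals the source lattice flips:

* `Consts.TwoSource.core₂_anti` — for `S, S', X, Y ⊆ U` and ANTITONE `F, G ≥ 0` (sum form, percolation restricted to `U`):
  `E[F(C_S) 1{S↮X}] · E[G(C_{S'}) 1{S'↮Y}] ≤ E[F G(C_{S∩S'}) 1{S∩S' ↮ X∪Y}] · P(S∪S' ↮ X∩Y)`.
* `Consts.twoSource_twoSet_antitone` — the same in measure form (`μ = prodBernoulli w`).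
At `S = S'`, `X = Y` this is van den Berg–Häggström–Kahn's Theorem 1.3 for two decreasing functions (RSA 2006, Thm 1.3, last sentence,
and Remark 2 after Thm 1.2).  Proof: BHK's induction on the vertex set exactly as in `core₂` (conditioning on the open star of
`Z = X∩Y`, `step_sum_set`, Ahlswede–Daykin on the star lattice, now with the decreasing product on the JOIN star and the bare avoidance
on the MEET star); only the base case `X∩Y = ∅` changes — Harris for two decreasing functions (`BHK2006.harris_anti_anti`) after the
pointwise source monotonicity `F(C_S)1{S↮X} ≤ F(C_{S∩S'})1{S∩S'↮X}`.  (The MIXED form — `F` increasing, `G` antitone: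
`E[FG(C_S);S↮X]·P[S'↮Y] ≤ E[F(C_{S∪S'});S∪S'↮X∩Y]·E[G(C_{S∩S'});S∩S'↮X∪Y]` — holds numerically (0 / 436, engine `master_mixed.py`) and has the
same proof skeleton; not in this file.)
Not in print in this form; derived here.  Exact numerical check (engine `prim-consts-2/g15/engines/master_anti.py`, random weights, n ≤ 5, m ≤ 8,
`G` over ALL decreasing 0/1 functionals by closure): 0 violations / 1 082; the other source orientation fails (732 / 1 082).
[cite: VandenbergHaggstromKahn2005, Thm. 1.1 (pp. 3–5), Thm. 1.3 (p. 6), Remark 2 after Thm. 1.2 (p. 5)]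
-/

noncomputable section

namespace Summit.CriticalPhenomena.PercolationContinuityZ3.Theorems

open MeasureTheory Set Literature.Probability.LatticeModels Literature.Probability.Percolation
open Literature.Probability.Percolation.BHK2006 DecisionTree
open scoped Classical

namespace Consts

namespace TwoSource

variable {V : Type*}

/-- `{S ↮ X}` is antitone in the source set. [folklore] -/
theorem rDS_antitone_source {U : Finset V} {S S' X : Set V} (h : S ⊆ S') : rDS U S' X ⊆ rDS U S X :=
  fun _ hω s hs x hx => hω s (h hs) x hx

/-- `{S ↮ X} ∩ {S ↮ Y} ⊆ {S ↮ X ∪ Y}` (in fact equality). [cite: VandenbergHaggstromKahn2005, §1 p. 4] -/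
theorem rDS_inter_subset_union (U : Finset V) (S X Y : Set V) : rDS U S X ∩ rDS U S Y ⊆ rDS U S (X ∪ Y) := by
  rintro ω ⟨h1, h2⟩ s hs x (hx | hx)
  · exact h1 s hs x hx
  · exact h2 s hs x hx

variable [Fintype V]

/-- **Two-source BHK for two DECREASING functionals (sum form, percolation restricted to `U`).**  For `S, S', X, Y ⊆ U` and
antitone `F, G ≥ 0`:
`E[F(C_S) 1{S↮X}] · E[G(C_{S'}) 1{S'↮Y}] ≤ E[F G(C_{S∩S'}) 1{S∩S' ↮ X∪Y}] · P(S∪S' ↮ X∩Y)`.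
[cite: VandenbergHaggstromKahn2005, Thm. 1.1 (pp. 3–5), Thm. 1.3 (p. 6) — two-source form derived here] -/
theorem core₂_anti (w : Sym2 V → ℝ) (hw0 : ∀ e, 0 ≤ w e) (hw1 : ∀ e, w e ≤ 1)
    (hm : ∑ ω, weight w ω = 1) (U : Finset V) :
    ∀ (S S' : Set V), S ⊆ ↑U → S' ⊆ ↑U → ∀ (X Y : Set V), X ⊆ ↑U → Y ⊆ ↑U →
    ∀ (F G : Set (Sym2 V) → ℝ), Antitone F → Antitone G → (∀ a, 0 ≤ F a) → (∀ a, 0 ≤ G a) →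
    (∑ ω, weight w ω * (F (rCS U S ω) * ind (rDS U S X) ω)) *
      (∑ ω, weight w ω * (G (rCS U S' ω) * ind (rDS U S' Y) ω)) ≤
    (∑ ω, weight w ω * (F (rCS U (S ∩ S') ω) * G (rCS U (S ∩ S') ω) *
        ind (rDS U (S ∩ S') (X ∪ Y)) ω)) *
      (∑ ω, weight w ω * ind (rDS U (S ∪ S') (X ∩ Y)) ω) := by
  induction U using Finset.strongInduction with
  | H U ih =>
  intro S S' hSU hS'U X Y hXU hYU F G hF hG hF0 hG0
  have hRHS : 0 ≤ (∑ ω, weight w ω * (F (rCS U (S ∩ S') ω) * G (rCS U (S ∩ S') ω) *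
      ind (rDS U (S ∩ S') (X ∪ Y)) ω)) * (∑ ω, weight w ω * ind (rDS U (S ∪ S') (X ∩ Y)) ω) :=
    mul_nonneg (Finset.sum_nonneg fun ω _ => mul_nonneg (weight_nonneg hw0 hw1 ω)
      (mul_nonneg (mul_nonneg (hF0 _) (hG0 _)) (ind_nonneg _ _)))
      (Finset.sum_nonneg fun ω _ => mul_nonneg (weight_nonneg hw0 hw1 ω) (ind_nonneg _ _))
  by_cases hSX : ∃ s ∈ S, s ∈ X
  · obtain ⟨s, hs, hsX⟩ := hSX
    have h0 : ∑ ω, weight w ω * (F (rCS U S ω) * ind (rDS U S X) ω) = 0 :=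
      Finset.sum_eq_zero fun ω _ => by
        rw [rDS_eq_empty hs hsX, ind_of_not_mem (Set.notMem_empty ω)]; ring
    rw [h0, zero_mul]; exact hRHS
  by_cases hSY : ∃ s ∈ S', s ∈ Y
  · obtain ⟨s, hs, hsY⟩ := hSY
    have h0 : ∑ ω, weight w ω * (G (rCS U S' ω) * ind (rDS U S' Y) ω) = 0 :=
      Finset.sum_eq_zero fun ω _ => by
        rw [rDS_eq_empty hs hsY, ind_of_not_mem (Set.notMem_empty ω)]; ring
    rw [h0, mul_zero]; exact hRHS
  push Not at hSX hSY
  set Z : Finset V := U.filter fun v => v ∈ X ∧ v ∈ Y with hZ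
  have hZU : Z ⊆ U := Finset.filter_subset _ _
  have hmemZ : ∀ v, v ∈ Z ↔ v ∈ X ∧ v ∈ Y := fun v => by
    simp only [hZ, Finset.mem_filter, and_iff_right_iff_imp]
    exact fun h => hXU h.1
  have hSZ : ∀ s ∈ S, s ∉ Z := fun s hs h => hSX s hs ((hmemZ s).1 h).1
  have hS'Z : ∀ s ∈ S', s ∉ Z := fun s hs h => hSY s hs ((hmemZ s).1 h).2
  have hSS'Z : ∀ s ∈ S ∪ S', s ∉ Z := fun s hs => hs.elim (hSZ s) (hS'Z s)
  have hSiZ : ∀ s ∈ S ∩ S', s ∉ Z := fun s hs => hSZ s hs.1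
  rcases Z.eq_empty_or_nonempty with hZe | hZne
  · /- base case: pointwise source monotonicity, then Harris for two decreasing functions -/
    have hXY : ∀ ω, ind (rDS U (S ∪ S') (X ∩ Y)) ω = 1 := fun ω =>
      ind_of_mem fun s _ x hx _ => by
        have : x ∈ Z := (hmemZ x).2 hx
        rw [hZe] at this
        exact absurd this (Finset.notMem_empty x)
    simp_rw [hXY, mul_one, hm]
    -- the two decreasing functions of the configuration
    set f : Set (Sym2 V) → ℝ := fun ω => F (rCS U (S ∩ S') ω) * ind (rDS U (S ∩ S') X) ω with hf
    set g : Set (Sym2 V) → ℝ := fun ω => G (rCS U (S ∩ S') ω) * ind (rDS U (S ∩ S') Y) ω with hg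
    have hfa : Antitone f := fun a b hab => mul_le_mul (hF (rCS_mono U _ hab)) (ind_rDS_antitone U _ X hab)
      (ind_nonneg _ _) (hF0 _)
    have hga : Antitone g := fun a b hab => mul_le_mul (hG (rCS_mono U _ hab)) (ind_rDS_antitone U _ Y hab)
      (ind_nonneg _ _) (hG0 _)
    have hfM : ∀ a, f a ≤ F ∅ := fun a =>
      (mul_le_of_le_one_right (hF0 _) (ind_le_one _ _)).trans (hF (Set.empty_subset _))
    have hgM : ∀ a, g a ≤ G ∅ := fun a =>
      (mul_le_of_le_one_right (hG0 _) (ind_le_one _ _)).trans (hG (Set.empty_subset _))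
    -- pointwise source monotonicities
    have h1 : ∑ ω, weight w ω * (F (rCS U S ω) * ind (rDS U S X) ω) ≤ ∑ ω, weight w ω * f ω :=
      Finset.sum_le_sum fun ω _ => mul_le_mul_of_nonneg_left
        (mul_le_mul (hF (rCS_mono_source U inter_subset_left ω))
          (ind_mono (rDS_antitone_source (U := U) (X := X) inter_subset_left) ω) (ind_nonneg _ _) (hF0 _))
        (weight_nonneg hw0 hw1 ω)
    have h2 : ∑ ω, weight w ω * (G (rCS U S' ω) * ind (rDS U S' Y) ω) ≤ ∑ ω, weight w ω * g ω :=
      Finset.sum_le_sum fun ω _ => mul_le_mul_of_nonneg_left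
        (mul_le_mul (hG (rCS_mono_source U inter_subset_right ω))
          (ind_mono (rDS_antitone_source (U := U) (X := Y) inter_subset_right) ω) (ind_nonneg _ _) (hG0 _))
        (weight_nonneg hw0 hw1 ω)
    have h3 : (∑ ω, weight w ω * f ω) * (∑ ω, weight w ω * g ω) ≤ ∑ ω, weight w ω * (f ω * g ω) :=
      harris_anti_anti hw0 hw1 hm hfa hga hfM hgM
    have h4 : ∑ ω, weight w ω * (f ω * g ω) ≤
        ∑ ω, weight w ω * (F (rCS U (S ∩ S') ω) * G (rCS U (S ∩ S') ω) * ind (rDS U (S ∩ S') (X ∪ Y)) ω) := by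
      refine Finset.sum_le_sum fun ω _ => mul_le_mul_of_nonneg_left ?_ (weight_nonneg hw0 hw1 ω)
      have e : f ω * g ω = F (rCS U (S ∩ S') ω) * G (rCS U (S ∩ S') ω) *
          (ind (rDS U (S ∩ S') X) ω * ind (rDS U (S ∩ S') Y) ω) := by simp only [hf, hg]; ring
      rw [e, ← ind_inter]
      exact mul_le_mul_of_nonneg_left (ind_mono (rDS_inter_subset_union U _ X Y) ω)
        (mul_nonneg (hF0 _) (hG0 _))
    have hn1 : 0 ≤ ∑ ω, weight w ω * (F (rCS U S ω) * ind (rDS U S X) ω) :=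
      sum_ind_nonneg hw0 hw1 (fun _ => hF0 _) _
    have hgn : 0 ≤ ∑ ω, weight w ω * g ω :=
      Finset.sum_nonneg fun ω _ => mul_nonneg (weight_nonneg hw0 hw1 ω) (mul_nonneg (hG0 _) (ind_nonneg _ _))
    calc (∑ ω, weight w ω * (F (rCS U S ω) * ind (rDS U S X) ω)) *
          (∑ ω, weight w ω * (G (rCS U S' ω) * ind (rDS U S' Y) ω))
        ≤ (∑ ω, weight w ω * f ω) * (∑ ω, weight w ω * g ω) :=
          mul_le_mul h1 h2 (sum_ind_nonneg hw0 hw1 (fun _ => hG0 _) _)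
            (Finset.sum_nonneg fun ω _ => mul_nonneg (weight_nonneg hw0 hw1 ω)
              (mul_nonneg (hF0 _) (ind_nonneg _ _)))
      _ ≤ _ := by rw [mul_one]; exact h3.trans h4
  · /- inductive step: as in `core₂`, with the decreasing product on the JOIN star and the bare avoidance on the MEET star -/
    have hss : U \ Z ⊂ U := Finset.sdiff_ssubset hZU hZne
    have hSU' : S ⊆ ↑(U \ Z) := fun s hs => by
      rw [Finset.coe_sdiff]; exact ⟨hSU hs, fun h => hSZ s hs h⟩
    have hS'U' : S' ⊆ ↑(U \ Z) := fun s hs => by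
      rw [Finset.coe_sdiff]; exact ⟨hS'U hs, fun h => hS'Z s hs h⟩
    have hZX : (↑Z : Set V) ⊆ X := fun v hv => ((hmemZ v).1 hv).1
    have hZY : (↑Z : Set V) ⊆ Y := fun v hv => ((hmemZ v).1 hv).2
    have hZXY : (↑Z : Set V) ⊆ X ∩ Y := fun v hv => (hmemZ v).1 hv
    have hZXuY : (↑Z : Set V) ⊆ X ∪ Y := fun v hv => Or.inl (((hmemZ v).1 hv).1)
    have e1 := step_sum_set hZU hSZ hZX w hm F
    have e2 := step_sum_set hZU hS'Z hZY w hm G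
    have e3 : ∑ ω, weight w ω * (F (rCS U (S ∩ S') ω) * G (rCS U (S ∩ S') ω) *
        ind (rDS U (S ∩ S') (X ∪ Y)) ω) =
        ∑ ω, weight w ω * blockES w (U \ Z) (S ∩ S') (fun a => F a * G a) ((X ∪ Y) \ ↑Z) (rS U Z ω) :=
      step_sum_set hZU hSiZ hZXuY w hm (fun a => F a * G a)
    have e4 : ∑ ω, weight w ω * ind (rDS U (S ∪ S') (X ∩ Y)) ω =
        ∑ ω, weight w ω * blockES w (U \ Z) (S ∪ S') (fun _ => 1) ((X ∩ Y) \ ↑Z) (rS U Z ω) := by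
      have := step_sum_set hZU hSS'Z hZXY w hm (fun _ => 1)
      simpa only [one_mul] using this
    rw [e1, e2, e3, e4, mul_comm (∑ ω, weight w ω * blockES w (U \ Z) (S ∩ S') _ _ _)]
    refine four_functions_theorem_univ
      (fun ω => weight w ω * blockES w (U \ Z) S F (X \ ↑Z) (rS U Z ω))
      (fun ω => weight w ω * blockES w (U \ Z) S' G (Y \ ↑Z) (rS U Z ω))
      (fun ω => weight w ω * blockES w (U \ Z) (S ∪ S') (fun _ => 1) ((X ∩ Y) \ ↑Z) (rS U Z ω))
      (fun ω => weight w ω * blockES w (U \ Z) (S ∩ S') (fun a => F a * G a) ((X ∪ Y) \ ↑Z) (rS U Z ω))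
      (fun ω => mul_nonneg (weight_nonneg hw0 hw1 ω) (blockES_nonneg hw0 hw1 _ _ hF0 _ _))
      (fun ω => mul_nonneg (weight_nonneg hw0 hw1 ω) (blockES_nonneg hw0 hw1 _ _ hG0 _ _))
      (fun ω => mul_nonneg (weight_nonneg hw0 hw1 ω)
        (blockES_nonneg hw0 hw1 _ _ (fun _ => zero_le_one) _ _))
      (fun ω => mul_nonneg (weight_nonneg hw0 hw1 ω)
        (blockES_nonneg hw0 hw1 _ _ (fun a => mul_nonneg (hF0 a) (hG0 a)) _ _))
      fun a b => ?_
    set Sa := rS U Z a with hSa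
    set Sb := rS U Z b with hSb
    have hX1 : X \ ↑Z ∪ Sa ⊆ ↑(U \ Z) := Set.union_subset
      (fun v hv => by rw [Finset.coe_sdiff]; exact ⟨hXU hv.1, hv.2⟩) (rS_subset U Z a)
    have hY1 : Y \ ↑Z ∪ Sb ⊆ ↑(U \ Z) := Set.union_subset
      (fun v hv => by rw [Finset.coe_sdiff]; exact ⟨hYU hv.1, hv.2⟩) (rS_subset U Z b)
    have IH := ih (U \ Z) hss S S' hSU' hS'U' (X \ ↑Z ∪ Sa) (Y \ ↑Z ∪ Sb) hX1 hY1 F G hF hG hF0 hG0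
    have hsub3 : (X ∩ Y) \ ↑Z ∪ rS U Z (a ∩ b) ⊆ (X \ ↑Z ∪ Sa) ∩ (Y \ ↑Z ∪ Sb) := by
      refine Set.union_subset (fun v hv => ⟨Or.inl ⟨hv.1.1, hv.2⟩, Or.inl ⟨hv.1.2, hv.2⟩⟩) ?_
      exact fun v hv =>
        ⟨Or.inr (rS_inter_subset U Z a b hv).1, Or.inr (rS_inter_subset U Z a b hv).2⟩
    have hsub4 : (X ∪ Y) \ ↑Z ∪ rS U Z (a ∪ b) ⊆ (X \ ↑Z ∪ Sa) ∪ (Y \ ↑Z ∪ Sb) := by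
      rw [rS_union]
      rintro v (⟨hXY | hXY, hvZ⟩ | hS | hS)
      · exact Or.inl (Or.inl ⟨hXY, hvZ⟩)
      · exact Or.inr (Or.inl ⟨hXY, hvZ⟩)
      · exact Or.inl (Or.inr hS)
      · exact Or.inr (Or.inr hS)
    have h3 : ∑ ω, weight w ω * (F (rCS (U \ Z) (S ∩ S') ω) * G (rCS (U \ Z) (S ∩ S') ω) *
        ind (rDS (U \ Z) (S ∩ S') ((X \ ↑Z ∪ Sa) ∪ (Y \ ↑Z ∪ Sb))) ω) ≤
        blockES w (U \ Z) (S ∩ S') (fun a => F a * G a) ((X ∪ Y) \ ↑Z) (rS U Z (a ∪ b)) :=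
      sum_ind_mono hw0 hw1 (fun ω => mul_nonneg (hF0 _) (hG0 _)) (rDS_antitone hsub4)
    have h4 : ∑ ω, weight w ω * ind (rDS (U \ Z) (S ∪ S') ((X \ ↑Z ∪ Sa) ∩ (Y \ ↑Z ∪ Sb))) ω ≤
        blockES w (U \ Z) (S ∪ S') (fun _ => 1) ((X ∩ Y) \ ↑Z) (rS U Z (a ∩ b)) := by
      have := sum_ind_mono hw0 hw1 (h := fun _ => (1 : ℝ)) (fun _ => zero_le_one)
        (rDS_antitone (U := U \ Z) (S := S ∪ S') hsub3) (w := w)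
      simp only [one_mul] at this
      simpa only [blockES, one_mul] using this
    have hIH' : blockES w (U \ Z) S F (X \ ↑Z) Sa * blockES w (U \ Z) S' G (Y \ ↑Z) Sb ≤
        blockES w (U \ Z) (S ∩ S') (fun a => F a * G a) ((X ∪ Y) \ ↑Z) (rS U Z (a ∪ b)) *
          blockES w (U \ Z) (S ∪ S') (fun _ => 1) ((X ∩ Y) \ ↑Z) (rS U Z (a ∩ b)) :=
      IH.trans (mul_le_mul h3 h4 (Finset.sum_nonneg fun ω _ =>
        mul_nonneg (weight_nonneg hw0 hw1 ω) (ind_nonneg _ _))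
        (blockES_nonneg hw0 hw1 _ _ (fun a => mul_nonneg (hF0 a) (hG0 a)) _ _))
    have hwab := weight_inter_mul_union w a b
    show weight w a * blockES w (U \ Z) S F (X \ ↑Z) Sa *
        (weight w b * blockES w (U \ Z) S' G (Y \ ↑Z) Sb) ≤
      weight w (a ∩ b) * blockES w (U \ Z) (S ∪ S') (fun _ => 1) ((X ∩ Y) \ ↑Z) (rS U Z (a ∩ b)) *
        (weight w (a ∪ b) * blockES w (U \ Z) (S ∩ S') (fun a => F a * G a) ((X ∪ Y) \ ↑Z) (rS U Z (a ∪ b)))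
    calc weight w a * blockES w (U \ Z) S F (X \ ↑Z) Sa *
          (weight w b * blockES w (U \ Z) S' G (Y \ ↑Z) Sb)
        = (weight w a * weight w b) *
          (blockES w (U \ Z) S F (X \ ↑Z) Sa * blockES w (U \ Z) S' G (Y \ ↑Z) Sb) := by ring
      _ ≤ (weight w (a ∩ b) * weight w (a ∪ b)) *
          (blockES w (U \ Z) (S ∩ S') (fun a => F a * G a) ((X ∪ Y) \ ↑Z) (rS U Z (a ∪ b)) *
            blockES w (U \ Z) (S ∪ S') (fun _ => 1) ((X ∩ Y) \ ↑Z) (rS U Z (a ∩ b))) := by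
          rw [hwab]
          exact mul_le_mul_of_nonneg_left hIH'
            (mul_nonneg (weight_nonneg hw0 hw1 _) (weight_nonneg hw0 hw1 _))
      _ = _ := by ring

end TwoSource

open TwoSource in
/-- **THEOREM (two-source two-set BHK for DECREASING functionals, measure form).**  For every finite weighted graph (`μ = prodBernoulli w`),
source sets `S, S'`, repelled sets `X, Y` and antitone `F, G ≥ 0` (functions of edge sets, read on the union clusters `C_A = ⋃_{a∈A} C_a`):
`(∫_{S↮X} F(C_S)) · (∫_{S'↮Y} G(C_{S'})) ≤ (∫_{S∩S'↮X∪Y} F G(C_{S∩S'})) · μ(S∪S' ↮ X∩Y)`.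
[cite: VandenbergHaggstromKahn2005, Thm. 1.1 (pp. 3–5), Thm. 1.3 (p. 6) — two-source form derived here] -/
theorem twoSource_twoSet_antitone {V : Type*} [Fintype V] (w : Sym2 V → unitInterval) (S S' X Y : Set V)
    (F G : Set (Sym2 V) → ℝ) (hF : Antitone F) (hG : Antitone G) (hF0 : ∀ C, 0 ≤ F C) (hG0 : ∀ C, 0 ≤ G C) :
    (∫ ω in {ω : BondConfig V | ∀ s ∈ S, ∀ x ∈ X, ¬ (openGraph ω).Reachable s x},
        F (⋃ s ∈ S, openEdgeCluster ω s) ∂(prodBernoulli w)) *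
      (∫ ω in {ω : BondConfig V | ∀ s ∈ S', ∀ x ∈ Y, ¬ (openGraph ω).Reachable s x},
        G (⋃ s ∈ S', openEdgeCluster ω s) ∂(prodBernoulli w)) ≤
    (∫ ω in {ω : BondConfig V | ∀ s ∈ S ∩ S', ∀ x ∈ X ∪ Y, ¬ (openGraph ω).Reachable s x},
        F (⋃ s ∈ S ∩ S', openEdgeCluster ω s) * G (⋃ s ∈ S ∩ S', openEdgeCluster ω s)
          ∂(prodBernoulli w)) *
      (prodBernoulli w).real {ω : BondConfig V | ∀ s ∈ S ∪ S', ∀ x ∈ X ∩ Y,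
        ¬ (openGraph ω).Reachable s x} := by
  classical
  set w' : Sym2 V → ℝ := fun e => (w e : ℝ) with hw'
  have hw0 : ∀ e, 0 ≤ w' e := fun e => (w e).2.1
  have hw1 : ∀ e, w' e ≤ 1 := fun e => (w e).2.2
  have hint : ∀ (D : Set (BondConfig V)) (h : Set (Sym2 V) → ℝ),
      ∫ ω in D, h ω ∂(prodBernoulli w) = ∑ ω, weight w' ω * (h ω * ind D ω) := by
    intro D h
    rw [← integral_indicator (MeasurableSet.of_discrete : MeasurableSet D), integral_prodBernoulli_eq_sum]
    refine Finset.sum_congr rfl fun ω _ => ?_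
    by_cases hω : ω ∈ D
    · rw [Set.indicator_of_mem hω, ind_of_mem hω, mul_one]
    · rw [Set.indicator_of_notMem hω, ind_of_not_mem hω]; ring
  have hreal : ∀ D : Set (BondConfig V), (prodBernoulli w).real D = ∑ ω, weight w' ω * ind D ω := by
    intro D
    rw [← integral_indicator_one (MeasurableSet.of_discrete : MeasurableSet D),
      integral_prodBernoulli_eq_sum]
    refine Finset.sum_congr rfl fun ω _ => ?_
    by_cases hω : ω ∈ D
    · rw [Set.indicator_of_mem hω, ind_of_mem hω, Pi.one_apply]
    · rw [Set.indicator_of_notMem hω, ind_of_not_mem hω, mul_zero]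
  have hm : ∑ ω, weight w' ω = 1 := by
    have h1 := integral_prodBernoulli_eq_sum w fun _ => (1 : ℝ)
    simp only [integral_const, probReal_univ, smul_eq_mul, mul_one] at h1
    exact h1.symm
  have hE : ∀ ω : Set (Sym2 V), ω ∩ BHK2006.edgesIn (Finset.univ : Finset V) = ω := fun ω => by
    ext e
    simp only [Set.mem_inter_iff, BHK2006.edgesIn, Set.mem_setOf_eq, Finset.mem_univ, imp_true_iff,
      and_true]
  have hC : ∀ (A : Set V) (ω : Set (Sym2 V)), rCS Finset.univ A ω = ⋃ s ∈ A, openEdgeCluster ω s :=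
    fun A ω => by simp only [rCS, rC, hE]
  have hDD : ∀ (A W : Set V), rDS Finset.univ A W =
      {ω : BondConfig V | ∀ s ∈ A, ∀ x ∈ W, ¬ (openGraph ω).Reachable s x} := fun A W => by
    ext ω
    simp only [rDS, hE, Set.mem_setOf_eq]
  have hsub : ∀ A : Set V, A ⊆ ↑(Finset.univ : Finset V) := fun A => by simp
  have key := core₂_anti w' hw0 hw1 hm Finset.univ S S' (hsub S) (hsub S') X Y (hsub X) (hsub Y)
    F G hF hG hF0 hG0
  simp only [hC, hDD] at key
  rw [hint, hint, hint, hreal]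
  exact key

end Consts

end Summit.CriticalPhenomena.PercolationContinuityZ3.Theorems

end
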